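import Mathlib

/-!
# Points of a lattice class in a box (solo-ABC-informed, s8)

Sharpest-statement artefact for `Summit.ABC` (family `abc`, soloist `solo-ABC-informed`, paper
§2.2(i)/§2.3, Theorem E).  This file is the geometry-of-numbers half of the *floor of the
two-logarithm method*: a counting lemma with no arithmetic in it.

Setting.  `Λ ⊆ ℤ²` is closed under subtraction and integer multiples (a subgroup), every
non-zero `v = (m, n) ∈ Λ` has weighted norm `N(v) = |m|·h₁ + |n|·h₂ ≥ λ > 0`, and all
determinants `det(v, w)`, `v, w ∈ Λ`, are divisible by an integer `g ≥ 1` (so `Λ` has index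
`≥ g`).  Let `F ⊆ [0, R-1] × [0, S-1]` be a finite set of integer points all of whose pairwise
differences lie in `Λ` (a piece of one class modulo `Λ`).  Then, with `T = (R-1)·h₁ + (S-1)·h₂`,

  `#F ≤ 2·T² / (g·h₁·h₂) + T / λ + 1`            (`soloInformed_lattice_class_box_count`).

Proof.  Take `v₁ ∈ Λ ∖ 0` of minimal norm among the lattice vectors in the difference box
`[-(R-1), R-1] × [-(S-1), S-1]` (non-empty as soon as `#F ≥ 2`); `λ ≤ N(v₁) ≤ T`.  Euclidean
division shows that a vector of `Λ` parallel to `v₁` is an *integer* multiple of `v₁` (a shorter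
remainder would lie in the box).  The map `u ↦ det(u - u₀, v₁)` takes values in `g·ℤ` on `F`,
with spread `≤ (R-1)|n₁| + (S-1)|m₁| ≤ T·N(v₁)/(h₁h₂)`, hence at most `T·N(v₁)/(g h₁h₂) + 1`
values; each fibre is contained in a translate of `ℤ·v₁` and meets the box in at most
`T/N(v₁) + 1` points.  Multiplying out and using `λ ≤ N(v₁) ≤ T` gives the bound.  The constant
`1` in front of `T/λ` (not `2`) is what the arithmetic application needs.

In `SoloInformedTwoLogFloor.lean` this is applied to the relation lattice
`Λ = {(m,n) : ᾱ₁^m ᾱ₂^n = 1 in 𝔽_p}` of two rational `p`-units, where `λ = log(p/2)` comes from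
the Liouville inequality and `g = lcm(ord ᾱ₁, ord ᾱ₂)`.

References: standard geometry of numbers; the statement and proof are ours
[new: solo-ABC-informed s8].
-/

open Finset

namespace Summit.ABC.ABC.Theorems

/-- A finite set of integers whose pairwise differences are divisible by `g ≥ 1` and bounded by
`D ≥ 0` has at most `D / g + 1` elements. [folklore] -/
theorem soloInformed_card_le_of_dvd_of_diam (I : Finset ℤ) {g : ℕ} (hg : 0 < g) {D : ℝ}
    (hD : 0 ≤ D) (hdvd : ∀ x ∈ I, ∀ y ∈ I, (g : ℤ) ∣ x - y)
    (hdiam : ∀ x ∈ I, ∀ y ∈ I, ((x - y : ℤ) : ℝ) ≤ D) :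
    (I.card : ℝ) ≤ D / g + 1 := by
  rcases I.eq_empty_or_nonempty with rfl | hne
  · simp only [card_empty, CharP.cast_eq_zero]; positivity
  have hm₀mem : I.min' hne ∈ I := Finset.min'_mem I hne
  have hgpos : (0 : ℤ) < g := by exact_mod_cast hg
  have hmap : ∀ x ∈ I, (x - I.min' hne) / (g : ℤ) ∈ Finset.Icc (0 : ℤ) (⌊D⌋ / (g : ℤ)) := by
    intro x hx
    rw [Finset.mem_Icc]
    have h1 : I.min' hne ≤ x := Finset.min'_le I x hx
    have h2 : x - I.min' hne ≤ ⌊D⌋ :=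
      Int.le_floor.mpr (by exact_mod_cast hdiam x hx _ hm₀mem)
    exact ⟨Int.ediv_nonneg (by linarith) hgpos.le, Int.ediv_le_ediv hgpos h2⟩
  have hinj : Set.InjOn (fun x : ℤ => (x - I.min' hne) / (g : ℤ)) I := by
    intro x hx y hy hxy
    have hx' := Int.ediv_mul_cancel (hdvd x hx _ hm₀mem)
    have hy' := Int.ediv_mul_cancel (hdvd y hy _ hm₀mem)
    simp only at hxy
    have : x - I.min' hne = y - I.min' hne := by rw [← hx', ← hy', hxy]
    linarith
  have hcard : I.card ≤ (Finset.Icc (0 : ℤ) (⌊D⌋ / (g : ℤ))).card :=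
    Finset.card_le_card_of_injOn _ hmap hinj
  rw [Int.card_Icc] at hcard
  have hq : ((⌊D⌋ / (g : ℤ) : ℤ) : ℝ) ≤ D / g := by
    rw [le_div_iff₀ (by exact_mod_cast hg)]
    have := Int.ediv_mul_le ⌊D⌋ (ne_of_gt hgpos)
    calc ((⌊D⌋ / (g : ℤ) : ℤ) : ℝ) * g = (((⌊D⌋ / (g : ℤ)) * (g : ℤ) : ℤ) : ℝ) := by norm_cast
      _ ≤ (⌊D⌋ : ℝ) := by exact_mod_cast this
      _ ≤ D := Int.floor_le D
  have hnn : (0 : ℤ) ≤ ⌊D⌋ / (g : ℤ) + 1 - 0 := by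
    have : (0 : ℤ) ≤ ⌊D⌋ / (g : ℤ) := Int.ediv_nonneg (Int.floor_nonneg.mpr hD) hgpos.le
    linarith
  calc (I.card : ℝ) ≤ ((⌊D⌋ / (g : ℤ) + 1 - 0).toNat : ℝ) := by exact_mod_cast hcard
    _ = ((⌊D⌋ / (g : ℤ) + 1 - 0 : ℤ) : ℝ) := by exact_mod_cast Int.toNat_of_nonneg hnn
    _ ≤ D / g + 1 := by push_cast; linarith

set_option maxHeartbeats 400000 in
/-- **Points of a lattice class in a box.**  Let `Λ ⊆ ℤ × ℤ` be closed under subtraction and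
integer multiples, suppose every non-zero `v ∈ Λ` has weighted norm `|v.1|·h₁ + |v.2|·h₂ ≥ lam > 0`
and every determinant of two vectors of `Λ` is divisible by `g ≥ 1`.  If `F ⊆ [0,R-1] × [0,S-1]` is
finite with all pairwise differences in `Λ`, then with `T = (R-1)h₁ + (S-1)h₂`,
`#F ≤ 2T²/(g h₁ h₂) + T/lam + 1`. [new: solo-ABC-informed s8] -/
theorem soloInformed_lattice_class_box_count
    (Λ : Set (ℤ × ℤ)) (hsub : ∀ v ∈ Λ, ∀ w ∈ Λ, v - w ∈ Λ)
    (hsmul : ∀ (k : ℤ), ∀ v ∈ Λ, k • v ∈ Λ)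
    {h₁ h₂ lam : ℝ} (hh₁ : 0 < h₁) (hh₂ : 0 < h₂) (hlam : 0 < lam)
    (hLiou : ∀ v ∈ Λ, v ≠ 0 → lam ≤ |(v.1 : ℝ)| * h₁ + |(v.2 : ℝ)| * h₂)
    {g : ℕ} (hg : 0 < g)
    (hdet : ∀ v ∈ Λ, ∀ w ∈ Λ, (g : ℤ) ∣ v.1 * w.2 - v.2 * w.1)
    {R S : ℕ} (hR : 1 ≤ R) (hS : 1 ≤ S)
    (F : Finset (ℤ × ℤ))
    (hbox : ∀ u ∈ F, 0 ≤ u.1 ∧ u.1 ≤ (R : ℤ) - 1 ∧ 0 ≤ u.2 ∧ u.2 ≤ (S : ℤ) - 1)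
    (hcos : ∀ u ∈ F, ∀ u' ∈ F, u - u' ∈ Λ) :
    (F.card : ℝ) ≤ 2 * (((R : ℝ) - 1) * h₁ + ((S : ℝ) - 1) * h₂) ^ 2 / (g * h₁ * h₂)
        + (((R : ℝ) - 1) * h₁ + ((S : ℝ) - 1) * h₂) / lam + 1 := by
  classical
  set T : ℝ := ((R : ℝ) - 1) * h₁ + ((S : ℝ) - 1) * h₂ with hT
  have hR1 : (1 : ℤ) ≤ R := by exact_mod_cast hR
  have hS1 : (1 : ℤ) ≤ S := by exact_mod_cast hS
  have hR' : (0 : ℝ) ≤ (R : ℝ) - 1 := by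
    have : (1 : ℝ) ≤ R := by exact_mod_cast hR
    linarith
  have hS' : (0 : ℝ) ≤ (S : ℝ) - 1 := by
    have : (1 : ℝ) ≤ S := by exact_mod_cast hS
    linarith
  have hT0 : 0 ≤ T := add_nonneg (mul_nonneg hR' hh₁.le) (mul_nonneg hS' hh₂.le)
  have hghh : 0 < (g : ℝ) * h₁ * h₂ := by positivity
  -- the case `#F ≤ 1`
  by_cases hF1 : F.card ≤ 1
  · have h1 : (F.card : ℝ) ≤ 1 := by exact_mod_cast hF1
    have h2 : 0 ≤ 2 * T ^ 2 / (g * h₁ * h₂) := by positivity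
    have h3 : 0 ≤ T / lam := by positivity
    linarith
  push Not at hF1
  obtain ⟨u₀, hu₀, u₁, hu₁, hne⟩ := Finset.one_lt_card.mp hF1
  -- the weighted norm
  set N : ℤ × ℤ → ℝ := fun v => |(v.1 : ℝ)| * h₁ + |(v.2 : ℝ)| * h₂ with hN
  -- differences of points of `F`
  have hdiff : ∀ u ∈ F, ∀ u' ∈ F, |(u - u').1| ≤ (R : ℤ) - 1 ∧ |(u - u').2| ≤ (S : ℤ) - 1 := by
    intro u hu u' hu'
    obtain ⟨a1, a2, a3, a4⟩ := hbox u hu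
    obtain ⟨b1, b2, b3, b4⟩ := hbox u' hu'
    simp only [Prod.fst_sub, Prod.snd_sub]
    constructor <;> rw [abs_le] <;> constructor <;> linarith
  have hdiffR : ∀ u ∈ F, ∀ u' ∈ F,
      |((u - u').1 : ℝ)| ≤ (R : ℝ) - 1 ∧ |((u - u').2 : ℝ)| ≤ (S : ℝ) - 1 := by
    intro u hu u' hu'
    obtain ⟨c1, c2⟩ := hdiff u hu u' hu'
    constructor
    · rw [← Int.cast_abs]; exact_mod_cast c1
    · rw [← Int.cast_abs]; exact_mod_cast c2
  have hNdiff : ∀ u ∈ F, ∀ u' ∈ F, N (u - u') ≤ T := by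
    intro u hu u' hu'
    obtain ⟨c1, c2⟩ := hdiffR u hu u' hu'
    simp only [hN, hT]
    have e1 := mul_le_mul_of_nonneg_right c1 hh₁.le
    have e2 := mul_le_mul_of_nonneg_right c2 hh₂.le
    linarith
  -- lattice vectors in the difference box, and the shortest one
  set M : Finset (ℤ × ℤ) :=
    ((Finset.Icc (-((R : ℤ) - 1)) ((R : ℤ) - 1)) ×ˢ (Finset.Icc (-((S : ℤ) - 1)) ((S : ℤ) - 1))).filter
      (fun v => v ∈ Λ ∧ v ≠ 0) with hM
  have hMmem : ∀ v, v ∈ M ↔ (|v.1| ≤ (R : ℤ) - 1 ∧ |v.2| ≤ (S : ℤ) - 1) ∧ v ∈ Λ ∧ v ≠ 0 := by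
    intro v
    simp only [hM, Finset.mem_filter, Finset.mem_product, Finset.mem_Icc, abs_le]
  have hu01M : u₀ - u₁ ∈ M := by
    rw [hMmem]; exact ⟨hdiff u₀ hu₀ u₁ hu₁, hcos u₀ hu₀ u₁ hu₁, sub_ne_zero.mpr hne⟩
  obtain ⟨v₁, hv₁M, hv₁min⟩ := Finset.exists_min_image M N ⟨_, hu01M⟩
  obtain ⟨⟨hv₁1, hv₁2⟩, hv₁Λ, hv₁ne⟩ := (hMmem v₁).mp hv₁M
  have hlam₁ : lam ≤ N v₁ := hLiou v₁ hv₁Λ hv₁ne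
  have hlam₁pos : 0 < N v₁ := lt_of_lt_of_le hlam hlam₁
  have hlam₁T : N v₁ ≤ T := le_trans (hv₁min _ hu01M) (hNdiff u₀ hu₀ u₁ hu₁)
  have hNv₁ : N v₁ = |(v₁.1 : ℝ)| * h₁ + |(v₁.2 : ℝ)| * h₂ := rfl
  -- a lattice vector parallel to `v₁` is an integer multiple of `v₁`
  have hpar : ∀ w ∈ Λ, w.1 * v₁.2 = w.2 * v₁.1 → ∃ k : ℤ, w = k • v₁ := by
    intro w hw hprop
    by_cases hm : v₁.1 = 0
    · -- `v₁ = (0, n₁)` with `n₁ ≠ 0`, and `w.1 = 0`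
      have hn : v₁.2 ≠ 0 := fun h => hv₁ne (Prod.ext hm h)
      have hw1 : w.1 = 0 := by
        rw [hm, mul_zero] at hprop
        exact (mul_eq_zero.mp hprop).resolve_right hn
      have hkr : v₁.2 * (w.2 / v₁.2) + w.2 % v₁.2 = w.2 := Int.mul_ediv_add_emod w.2 v₁.2
      have hr0 : 0 ≤ w.2 % v₁.2 := Int.emod_nonneg _ hn
      have hrlt : w.2 % v₁.2 < |v₁.2| := Int.emod_lt_abs _ hn
      have hw'Λ : w - (w.2 / v₁.2) • v₁ ∈ Λ := hsub w hw _ (hsmul _ v₁ hv₁Λ)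
      have hw'1 : (w - (w.2 / v₁.2) • v₁).1 = 0 := by
        simp only [Prod.fst_sub, Prod.smul_fst, smul_eq_mul, hw1, hm, mul_zero, sub_zero]
      have hw'2 : (w - (w.2 / v₁.2) • v₁).2 = w.2 % v₁.2 := by
        simp only [Prod.snd_sub, Prod.smul_snd, smul_eq_mul]
        linear_combination (-1 : ℤ) * hkr
      by_cases hr : w.2 % v₁.2 = 0
      · refine ⟨w.2 / v₁.2, sub_eq_zero.mp (Prod.ext ?_ ?_)⟩
        · rw [hw'1, Prod.fst_zero]
        · rw [hw'2, hr, Prod.snd_zero]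
      · exfalso
        have hw'ne : w - (w.2 / v₁.2) • v₁ ≠ 0 := by
          intro h; apply hr; rw [← hw'2, h, Prod.snd_zero]
        have hw'M : w - (w.2 / v₁.2) • v₁ ∈ M := by
          rw [hMmem]
          refine ⟨⟨?_, ?_⟩, hw'Λ, hw'ne⟩
          · rw [hw'1, abs_zero]; linarith
          · rw [hw'2, abs_of_nonneg hr0]; linarith
        have hmin := hv₁min _ hw'M
        have hlt : N (w - (w.2 / v₁.2) • v₁) < N v₁ := by
          have e1 : ((w - (w.2 / v₁.2) • v₁).1 : ℝ) = 0 := by exact_mod_cast hw'1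
          have e2 : ((w - (w.2 / v₁.2) • v₁).2 : ℝ) = ((w.2 % v₁.2 : ℤ) : ℝ) := by
            exact_mod_cast hw'2
          have e3 : (((w.2 % v₁.2 : ℤ)) : ℝ) < |(v₁.2 : ℝ)| := by
            rw [← Int.cast_abs]; exact_mod_cast hrlt
          have e4 : (0 : ℝ) ≤ ((w.2 % v₁.2 : ℤ) : ℝ) := by exact_mod_cast hr0
          have e5 : (v₁.1 : ℝ) = 0 := by exact_mod_cast hm
          show |((w - (w.2 / v₁.2) • v₁).1 : ℝ)| * h₁ + |((w - (w.2 / v₁.2) • v₁).2 : ℝ)| * h₂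
              < |(v₁.1 : ℝ)| * h₁ + |(v₁.2 : ℝ)| * h₂
          rw [e1, e2, e5, abs_zero, abs_of_nonneg e4]
          nlinarith
        linarith
    · -- `m₁ = v₁.1 ≠ 0`
      have hkr : v₁.1 * (w.1 / v₁.1) + w.1 % v₁.1 = w.1 := Int.mul_ediv_add_emod w.1 v₁.1
      have hr0 : 0 ≤ w.1 % v₁.1 := Int.emod_nonneg _ hm
      have hrlt : w.1 % v₁.1 < |v₁.1| := Int.emod_lt_abs _ hm
      have hw'Λ : w - (w.1 / v₁.1) • v₁ ∈ Λ := hsub w hw _ (hsmul _ v₁ hv₁Λ)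
      have hw'1 : (w - (w.1 / v₁.1) • v₁).1 = w.1 % v₁.1 := by
        simp only [Prod.fst_sub, Prod.smul_fst, smul_eq_mul]
        linear_combination (-1 : ℤ) * hkr
      have hw'2 : (w - (w.1 / v₁.1) • v₁).2 = w.2 - (w.1 / v₁.1) * v₁.2 := by
        simp only [Prod.snd_sub, Prod.smul_snd, smul_eq_mul]
      have hprop' : (w - (w.1 / v₁.1) • v₁).1 * v₁.2 = (w - (w.1 / v₁.1) • v₁).2 * v₁.1 := by
        rw [hw'2, Prod.fst_sub, Prod.smul_fst, smul_eq_mul]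
        linear_combination hprop
      by_cases hr : w.1 % v₁.1 = 0
      · have h2 : (w - (w.1 / v₁.1) • v₁).2 = 0 := by
          rw [hw'1, hr, zero_mul] at hprop'
          exact (mul_eq_zero.mp hprop'.symm).resolve_right hm
        refine ⟨w.1 / v₁.1, sub_eq_zero.mp (Prod.ext ?_ ?_)⟩
        · rw [hw'1, hr, Prod.fst_zero]
        · rw [h2, Prod.snd_zero]
      · exfalso
        have hw'ne : w - (w.1 / v₁.1) • v₁ ≠ 0 := by
          intro h; apply hr; rw [← hw'1, h, Prod.fst_zero]
        have habs : |(w - (w.1 / v₁.1) • v₁).2| * |v₁.1| = (w.1 % v₁.1) * |v₁.2| := by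
          have := congrArg abs hprop'
          rw [abs_mul, abs_mul, hw'1, abs_of_nonneg hr0] at this
          linarith
        have hm0 : 0 < |v₁.1| := abs_pos.mpr hm
        have hb2 : |(w - (w.1 / v₁.1) • v₁).2| ≤ |v₁.2| := by
          by_contra hcon
          push Not at hcon
          nlinarith [abs_nonneg v₁.2, abs_nonneg (w - (w.1 / v₁.1) • v₁).2]
        have hw'M : w - (w.1 / v₁.1) • v₁ ∈ M := by
          rw [hMmem]
          refine ⟨⟨?_, ?_⟩, hw'Λ, hw'ne⟩
          · rw [hw'1, abs_of_nonneg hr0]; linarith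
          · exact le_trans hb2 hv₁2
        have hmin := hv₁min _ hw'M
        have hlt : N (w - (w.1 / v₁.1) • v₁) < N v₁ := by
          have e1 : ((w - (w.1 / v₁.1) • v₁).1 : ℝ) = ((w.1 % v₁.1 : ℤ) : ℝ) := by
            exact_mod_cast hw'1
          have e2 : |((w - (w.1 / v₁.1) • v₁).2 : ℝ)| * |(v₁.1 : ℝ)|
              = ((w.1 % v₁.1 : ℤ) : ℝ) * |(v₁.2 : ℝ)| := by
            rw [← Int.cast_abs, ← Int.cast_abs, ← Int.cast_abs]; exact_mod_cast habs
          have e3 : ((w.1 % v₁.1 : ℤ) : ℝ) < |(v₁.1 : ℝ)| := by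
            rw [← Int.cast_abs]; exact_mod_cast hrlt
          have e4 : (0 : ℝ) ≤ ((w.1 % v₁.1 : ℤ) : ℝ) := by exact_mod_cast hr0
          have key : (|((w - (w.1 / v₁.1) • v₁).1 : ℝ)| * h₁
              + |((w - (w.1 / v₁.1) • v₁).2 : ℝ)| * h₂) * |(v₁.1 : ℝ)|
              = ((w.1 % v₁.1 : ℤ) : ℝ) * (|(v₁.1 : ℝ)| * h₁ + |(v₁.2 : ℝ)| * h₂) := by
            rw [e1, abs_of_nonneg e4]
            linear_combination h₂ * e2
          show |((w - (w.1 / v₁.1) • v₁).1 : ℝ)| * h₁ + |((w - (w.1 / v₁.1) • v₁).2 : ℝ)| * h₂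
              < |(v₁.1 : ℝ)| * h₁ + |(v₁.2 : ℝ)| * h₂
          by_contra hcon
          push Not at hcon
          have hpos : 0 < |(v₁.1 : ℝ)| * h₁ + |(v₁.2 : ℝ)| * h₂ := hlam₁pos
          nlinarith [mul_le_mul_of_nonneg_right hcon (abs_nonneg (v₁.1 : ℝ))]
        linarith
  -- the determinant coordinate `J u = det(u - u₀, v₁)`
  set J : ℤ × ℤ → ℤ := fun u => (u.1 - u₀.1) * v₁.2 - (u.2 - u₀.2) * v₁.1 with hJ
  have hJdiff : ∀ u u' : ℤ × ℤ, J u - J u' = (u - u').1 * v₁.2 - (u - u').2 * v₁.1 := by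
    intro u u'; simp only [hJ, Prod.fst_sub, Prod.snd_sub]; ring
  set I := F.image J with hI
  set D : ℝ := ((R : ℝ) - 1) * |(v₁.2 : ℝ)| + ((S : ℝ) - 1) * |(v₁.1 : ℝ)| with hD
  have hD0 : 0 ≤ D := by positivity
  have hIdvd : ∀ x ∈ I, ∀ y ∈ I, (g : ℤ) ∣ x - y := by
    intro x hx y hy
    obtain ⟨u, hu, rfl⟩ := Finset.mem_image.mp hx
    obtain ⟨u', hu', rfl⟩ := Finset.mem_image.mp hy
    rw [hJdiff]; exact hdet _ (hcos u hu u' hu') _ hv₁Λ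
  have hIdiam : ∀ x ∈ I, ∀ y ∈ I, ((x - y : ℤ) : ℝ) ≤ D := by
    intro x hx y hy
    obtain ⟨u, hu, rfl⟩ := Finset.mem_image.mp hx
    obtain ⟨u', hu', rfl⟩ := Finset.mem_image.mp hy
    rw [hJdiff]
    obtain ⟨c1, c2⟩ := hdiffR u hu u' hu'
    push_cast
    have e1 : ((u - u').1 : ℝ) * (v₁.2 : ℝ) ≤ |((u - u').1 : ℝ)| * |(v₁.2 : ℝ)| := by
      rw [← abs_mul]; exact le_abs_self _
    have e2 : -(((u - u').2 : ℝ) * (v₁.1 : ℝ)) ≤ |((u - u').2 : ℝ)| * |(v₁.1 : ℝ)| := by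
      rw [← abs_mul]; exact neg_le_abs _
    have e3 := mul_le_mul_of_nonneg_right c1 (abs_nonneg (v₁.2 : ℝ))
    have e4 := mul_le_mul_of_nonneg_right c2 (abs_nonneg (v₁.1 : ℝ))
    simp only [Prod.fst_sub, Prod.snd_sub, Int.cast_sub] at e1 e2 e3 e4 ⊢
    linarith
  have hIcard : (I.card : ℝ) ≤ D / g + 1 :=
    soloInformed_card_le_of_dvd_of_diam I hg hD0 hIdvd hIdiam
  -- each fibre of `J` on `F` lies on a translate of `ℤ • v₁`
  have hfib : ∀ c ∈ I, ((F.filter (fun u => J u = c)).card : ℝ) ≤ T / N v₁ + 1 := by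
    intro c hc
    obtain ⟨b, hbF, hb⟩ := Finset.mem_image.mp hc
    have hbFc : b ∈ F.filter (fun u => J u = c) := Finset.mem_filter.mpr ⟨hbF, hb⟩
    have hk : ∀ u ∈ F.filter (fun u => J u = c), ∃ k : ℤ, u - b = k • v₁ := by
      intro u hu
      rw [Finset.mem_filter] at hu
      apply hpar _ (hcos u hu.1 b hbF)
      have := hJdiff u b
      rw [hu.2, hb, sub_self] at this
      linarith
    set θ : ℤ × ℤ → ℤ := fun u =>
      if v₁.1 ≠ 0 then (u.1 - b.1) / v₁.1 else (u.2 - b.2) / v₁.2 with hθ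
    have hθv : ∀ u ∈ F.filter (fun u => J u = c), u - b = θ u • v₁ := by
      intro u hu
      obtain ⟨k, hk⟩ := hk u hu
      have e1 : u.1 - b.1 = k * v₁.1 := by
        have := congrArg Prod.fst hk; simpa using this
      have e2 : u.2 - b.2 = k * v₁.2 := by
        have := congrArg Prod.snd hk; simpa using this
      have hθk : θ u = k := by
        by_cases hm : v₁.1 = 0
        · have hn : v₁.2 ≠ 0 := fun h => hv₁ne (Prod.ext hm h)
          simp only [hθ, hm, ne_eq, not_true_eq_false, if_false]
          rw [e2]; exact Int.mul_ediv_cancel k hn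
        · simp only [hθ, hm, ne_eq, not_false_eq_true, if_true]
          rw [e1]; exact Int.mul_ediv_cancel k hm
      rw [hθk]; exact hk
    have hθinj : Set.InjOn θ (F.filter (fun u => J u = c)) := by
      intro u hu u' hu' heq
      have h1 := hθv u hu
      have h2 := hθv u' hu'
      rw [heq, ← h2] at h1
      exact sub_left_inj.mp h1
    have hcardFc : ((F.filter (fun u => J u = c)).image θ).card
        = (F.filter (fun u => J u = c)).card := Finset.card_image_of_injOn hθinj
    have hImdiam : ∀ x ∈ (F.filter (fun u => J u = c)).image θ,
        ∀ y ∈ (F.filter (fun u => J u = c)).image θ, ((x - y : ℤ) : ℝ) ≤ T / N v₁ := by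
      intro x hx y hy
      obtain ⟨u, hu, rfl⟩ := Finset.mem_image.mp hx
      obtain ⟨u', hu', rfl⟩ := Finset.mem_image.mp hy
      have hdθ : u - u' = (θ u - θ u') • v₁ := by
        rw [sub_smul, ← hθv u hu, ← hθv u' hu']; abel
      have hNuu : N (u - u') ≤ T :=
        hNdiff u (Finset.mem_filter.mp hu).1 u' (Finset.mem_filter.mp hu').1
      have hNeq : N (u - u') = |((θ u - θ u' : ℤ) : ℝ)| * N v₁ := by
        simp only [hN, hdθ, Prod.smul_fst, Prod.smul_snd, smul_eq_mul, Int.cast_mul, abs_mul]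
        ring
      rw [le_div_iff₀ hlam₁pos]
      calc ((θ u - θ u' : ℤ) : ℝ) * N v₁ ≤ |((θ u - θ u' : ℤ) : ℝ)| * N v₁ :=
            mul_le_mul_of_nonneg_right (le_abs_self _) hlam₁pos.le
        _ = N (u - u') := hNeq.symm
        _ ≤ T := hNuu
    have := soloInformed_card_le_of_dvd_of_diam ((F.filter (fun u => J u = c)).image θ)
      (g := 1) one_pos (D := T / N v₁) (by positivity) (by intros; simp) hImdiam
    rw [hcardFc] at this
    simpa using this
  -- sum over the fibres
  have hsum : F.card = ∑ c ∈ I, (F.filter (fun u => J u = c)).card :=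
    Finset.card_eq_sum_card_fiberwise (fun u hu => Finset.mem_image_of_mem J hu)
  have hFle : (F.card : ℝ) ≤ (I.card : ℝ) * (T / N v₁ + 1) := by
    rw [hsum]
    push_cast
    calc ∑ c ∈ I, ((F.filter (fun u => J u = c)).card : ℝ) ≤ ∑ c ∈ I, (T / N v₁ + 1) :=
          Finset.sum_le_sum hfib
      _ = I.card * (T / N v₁ + 1) := by rw [Finset.sum_const, nsmul_eq_mul]
  -- the final inequality
  have hDT : D * (h₁ * h₂) ≤ T * N v₁ := by
    have a1 : ((R : ℝ) - 1) * h₁ ≤ T := by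
      rw [hT]; nlinarith
    have a2 : ((S : ℝ) - 1) * h₂ ≤ T := by
      rw [hT]; nlinarith
    have e1 := mul_le_mul_of_nonneg_right a1 (mul_nonneg (abs_nonneg (v₁.2 : ℝ)) hh₂.le)
    have e2 := mul_le_mul_of_nonneg_right a2 (mul_nonneg (abs_nonneg (v₁.1 : ℝ)) hh₁.le)
    rw [hNv₁, hD]
    nlinarith
  have p1 : D * T / (g * N v₁) ≤ T ^ 2 / (g * h₁ * h₂) := by
    rw [div_le_div_iff₀ (by positivity) (by positivity)]
    have := mul_le_mul_of_nonneg_left hDT (by positivity : (0 : ℝ) ≤ (g : ℝ) * T)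
    calc D * T * (g * h₁ * h₂) = (g * T) * (D * (h₁ * h₂)) := by ring
      _ ≤ (g * T) * (T * N v₁) := this
      _ = T ^ 2 * (g * N v₁) := by ring
  have p2 : D / g ≤ T ^ 2 / (g * h₁ * h₂) := by
    rw [div_le_div_iff₀ (by positivity) (by positivity)]
    have := mul_le_mul_of_nonneg_left hlam₁T hT0
    calc D * (g * h₁ * h₂) = g * (D * (h₁ * h₂)) := by ring
      _ ≤ g * (T * N v₁) := mul_le_mul_of_nonneg_left hDT (by positivity)
      _ ≤ g * (T * T) := mul_le_mul_of_nonneg_left this (by positivity)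
      _ = T ^ 2 * g := by ring
  have p3 : T / N v₁ ≤ T / lam := div_le_div_of_nonneg_left hT0 hlam hlam₁
  calc (F.card : ℝ) ≤ (D / g + 1) * (T / N v₁ + 1) :=
        le_trans hFle (mul_le_mul_of_nonneg_right hIcard (by positivity))
    _ = D * T / (g * N v₁) + D / g + T / N v₁ + 1 := by ring
    _ ≤ T ^ 2 / (g * h₁ * h₂) + T ^ 2 / (g * h₁ * h₂) + T / lam + 1 := by linarith
    _ = 2 * T ^ 2 / (g * h₁ * h₂) + T / lam + 1 := by ring

end Summit.ABC.ABC.Theorems
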